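import Summits.Langlands.Langlands.Statement
import Literature.NumberTheory.Automorphic.CarayolCompatibilityOfLocalGlobalProofs
import Literature.NumberTheory.Automorphic.GL2RSLFactorUnramifiedComputation
import Literature.NumberTheory.Automorphic.LocalComponentBJGenericProofs
import Literature.NumberTheory.Automorphic.LocalComponentBJSatakeProofs
import Literature.NumberTheory.Automorphic.SatakeParametersGLProofs
import Literature.NumberTheory.GaloisRepresentations.WeilDeligneRepFrobSemisimpleProofs
import HarnessLib

/-!
# Stub H4 of the line `Sketch` of the crux `ReciprocityUpToIrreducibility`:
# the automorphic side of the rank-`n` unramified matching, modulo the Jacquet–Shalika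
# unramified computation

For a cuspidal `π` on `GL_n(𝔸_K)` (`2 ≤ n`) with Satake parameter `α` at the finite place `v`, a
local component `π_v` of `π` at `v`, and ANY local Langlands datum `L` of `K_v`: granting the
Jacquet–Shalika unramified computation at `(n, 1)` for the pair `(π_v, 1)` (the named fact
`hasRSLFactor_of_isSatakeParameter_haar` of `RankinSelbergLocal`, a HYPOTHESIS here), every
Frobenius-semisimple representative `A` of `L.recGL n ⟦π_v⟧` has `N = 0`, is trivial on inertia,
and `char(A.ρ Φ) = ∏_{a ∈ α} (X - a)` for every geometric Frobenius `Φ`.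

The argument is the rank-`n` form of
`WeilDeligneRep.unramified_of_hasFrobSemisimpleClass_recGL_of_isSatakeParameter`
(`CarayolCompatibilityOfLocalGlobalProofs`, the `GL₂` case): clause (iii-L) `lFactor_pairs` of the
datum turns the hypothesis `HasRSLFactor (π_v, 1) (∏ (1 - a T))` into
`∏ (1 - a T) = det(1 - TΦ | (ker N)^I)` on `rec(π_v) ⊗ rec(1)`; all `a ≠ 0`
(`IsSatakeParameter.forall_ne_zero_holds`), so the degree is `n = dim`, `(ker N)^I` is everything
(`inertiaInvariantsKerN_eq_top_of_natDegree_eulerFactor_eq`,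
`N_eq_zero_and_inertia_trivial_of_tprod_eq_top`), `det(1 - TΦ) = ∏ (1 - a T)`
(`eulerFactor_eq_reverse_charpoly_of_eq_top`, `charpoly_tprod_ρ_eq`), i.e.
`char(Φ) = ∏ (X - a)` (reflection in degree `n`); this passes to the equivalent `A` and to every
geometric Frobenius (two of them differ by inertia).

## References

* H. Jacquet, J. A. Shalika, Amer. J. Math. 103 (1981), §2. [JacquetShalika1981]
* M. Harris, R. Taylor, Ann. of Math. Stud. 151 (2001), Thm. A (ii), (v). [HarrisTaylorAMS2001]
* J. Tate, *Number theoretic background*, Corvallis 1979, (4.1.6). [TateCorvallis1979]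
-/

open scoped MatrixGroups Matrix NumberField Classical Polynomial
open Filter IsDedekindDomain Field Polynomial Literature.NumberTheory.Automorphic
  Literature.NumberTheory.GaloisRepresentations Literature.NumberTheory.PAdicHodge Summit.Langlands

noncomputable section
set_option linter.dupNamespace false -- project-wide option (lakefile weak.linter.dupNamespace); `Summit.Langlands.Langlands` is the mandated namespace

namespace Summit.Langlands.Langlands.Theorems.ReciprocityUpToIrreducibility

open Literature.NumberTheory.EllipticCurves.Hida2000Thm326 (exists_haar_measure_quotient_fin_one)

/-! ### Polynomial bookkeeping: `∏ (1 - a X)` versus `∏ (X - a)` -/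

/-- `deg ∏_{a ∈ α} (1 - a X) ≤ card α` and `reflect (card α) ∏_{a ∈ α} (1 - a X) = ∏_{a ∈ α} (X - a)`.
[folklore] -/
theorem reflect_card_prod_one_sub_C_mul_X_recGLn (α : Multiset ℂ) :
    ((α.map fun a => (1 : ℂ[X]) - C a * X).prod).natDegree ≤ Multiset.card α ∧
      reflect (Multiset.card α) ((α.map fun a => (1 : ℂ[X]) - C a * X).prod) =
        (α.map fun a => X - C a).prod := by
  induction α using Multiset.induction_on with
  | empty => simp
  | cons a s ih =>
    obtain ⟨hdeg, hrefl⟩ := ih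
    have h1 : ((1 : ℂ[X]) - C a * X).natDegree ≤ 1 :=
      (natDegree_sub_le _ _).trans (max_le (by simp) ((natDegree_C_mul_le a X).trans natDegree_X_le))
    simp only [Multiset.map_cons, Multiset.prod_cons, Multiset.card_cons]
    refine ⟨natDegree_mul_le.trans (by omega), ?_⟩
    rw [add_comm, reflect_mul _ _ h1 hdeg, hrefl, reflect_sub, reflect_one, pow_one, reflect_C_mul,
      reflect_one_X, mul_one]

/-- `deg ∏_{a ∈ α} (1 - a X) = card α` when no `a` vanishes. [folklore] -/
theorem natDegree_prod_one_sub_C_mul_X_recGLn {α : Multiset ℂ} (h : ∀ a ∈ α, a ≠ 0) :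
    ((α.map fun a => (1 : ℂ[X]) - C a * X).prod).natDegree = Multiset.card α := by
  induction α using Multiset.induction_on with
  | empty => simp
  | cons a s ih =>
    have ha : a ≠ 0 := h a (Multiset.mem_cons_self a s)
    have hs := ih fun b hb => h b (Multiset.mem_cons_of_mem hb)
    have h1 : ((1 : ℂ[X]) - C a * X).natDegree = 1 := by
      rw [natDegree_sub_eq_right_of_natDegree_lt] <;> rw [natDegree_C_mul_X _ ha]
      simp
    have h1' : ((1 : ℂ[X]) - C a * X) ≠ 0 := fun h0 => by simpa using congrArg (eval 0) h0
    have hs' : (s.map fun a => (1 : ℂ[X]) - C a * X).prod ≠ 0 := fun h0 => by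
      simpa [eval_multiset_prod] using congrArg (eval 0) h0
    simp only [Multiset.map_cons, Multiset.prod_cons, Multiset.card_cons]
    rw [natDegree_mul h1' hs', h1, hs, add_comm]

/-- A polynomial of degree `card α` whose reverse is `∏_{a ∈ α} (1 - a X)` is `∏_{a ∈ α} (X - a)`.
[folklore] -/
theorem eq_prod_X_sub_C_of_reverse_eq_recGLn {p : ℂ[X]} {α : Multiset ℂ}
    (hdeg : p.natDegree = Multiset.card α)
    (hrev : p.reverse = (α.map fun a => (1 : ℂ[X]) - C a * X).prod) :
    p = (α.map fun a => X - C a).prod := by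
  rw [← (reflect_card_prod_one_sub_C_mul_X_recGLn α).2, ← hrev, Polynomial.reverse, hdeg,
    reflect_reflect]


/-! ### Weil–Deligne bookkeeping: equivalence transfer and change of geometric Frobenius -/

section WD

variable {F : Type} [Field F] [ValuativeRel F] [TopologicalSpace F] [IsNonarchimedeanLocalField F]
  {n : ℕ}

/-- If `r ≅ r'` and `r'` has `N = 0` and trivial inertia action, then so does `r`, and
`char(r.ρ w) = char(r'.ρ w)` for every `w ∈ W_F` (conjugation by the isomorphism).
[cite: TateCorvallis1979, (4.1.2)–(4.1.6)] -/
theorem wd_unramified_charpoly_of_isEquivalent_recGLn {r r' : WeilDeligneRep F ℂ (Fin n → ℂ)}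
    (h : r.IsEquivalent r') (hN : r'.N = 0) (hρ : ∀ u ∈ WeilGroup.inertia F, r'.ρ u = 1) :
    r.N = 0 ∧ WeilGroup.IsUnramifiedRep r.ρ ∧
      ∀ w : WeilGroup F, (r.ρ w).charpoly = (r'.ρ w).charpoly := by
  obtain ⟨e'⟩ := h
  set φ' : (Fin n → ℂ) ≃ₗ[ℂ] (Fin n → ℂ) := e'.toRepEquiv.toLinearEquiv with hφ'
  have hφ'ρ : ∀ (u : WeilGroup F) (y : Fin n → ℂ), φ' (r.ρ u y) = r'.ρ u (φ' y) := fun u y => by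
    rw [hφ', Representation.Equiv.toLinearEquiv_apply, Representation.Equiv.toLinearEquiv_apply]
    exact Representation.IntertwiningMap.isIntertwining _ _ e'.toRepEquiv.toIntertwiningMap u y
  have hφ'N : ∀ y : Fin n → ℂ, φ' (r.N y) = r'.N (φ' y) := fun y => LinearMap.congr_fun e'.comm_N y
  refine ⟨?_, fun u hu => ?_, fun w => ?_⟩
  · refine LinearMap.ext fun y => φ'.injective ?_
    rw [hφ'N, hN, LinearMap.zero_apply, LinearMap.zero_apply, map_zero]
  · refine LinearMap.ext fun y => φ'.injective ?_
    rw [hφ'ρ, hρ u hu]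
    rfl
  · have hconj : φ'.conj (r.ρ w) = r'.ρ w := by
      refine LinearMap.ext fun y => ?_
      simp only [LinearEquiv.conj_apply, LinearMap.comp_apply, LinearEquiv.coe_coe, hφ'ρ,
        LinearEquiv.apply_symm_apply]
    rw [← hconj, LinearEquiv.charpoly_conj]

/-- An unramified representation of `W_F` takes the same value at any two elements of the same
degree (they differ by inertia: `deg (Φ Φ'⁻¹) = 0`). [cite: TateCorvallis1979, (1.4.1), (4.1.6)] -/
theorem wd_apply_eq_of_isUnramifiedRep_of_deg_eq_recGLn {r : WeilDeligneRep F ℂ (Fin n → ℂ)}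
    (hρ : WeilGroup.IsUnramifiedRep r.ρ) {Φ Φ' : WeilGroup F}
    (h : WeilGroup.deg Φ = WeilGroup.deg Φ') : r.ρ Φ = r.ρ Φ' := by
  have hmem : Φ * Φ'⁻¹ ∈ WeilGroup.inertia F := by
    rw [← WeilGroup.deg_eq_zero_iff_mem_inertia IsFrobPow.mul_holds IsFrobPow.unique_holds,
      WeilGroup.deg_mul IsFrobPow.mul_holds IsFrobPow.unique_holds,
      WeilGroup.deg_inv IsFrobPow.mul_holds IsFrobPow.unique_holds, h, add_neg_cancel]
  calc r.ρ Φ = r.ρ (Φ * Φ'⁻¹ * Φ') := by rw [inv_mul_cancel_right]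
    _ = r.ρ Φ' := by rw [map_mul, hρ _ hmem, one_mul]

end WD

/-! ### The local deduction at a spherical generic `π_v` of `GL_n(F)` -/

section Local

variable {F : Type} [Field F] [ValuativeRel F] [TopologicalSpace F] [IsNonarchimedeanLocalField F]

/-- **The chosen representative of `rec(π_v)` is unramified with the Satake characteristic
polynomial**, modulo the Jacquet–Shalika unramified computation at `(n, 1)`.  Let `d` be a local
Langlands datum of `F`, `π_v` an irreducible smooth `ψ`-generic representation of `GL_n(F)`
(`2 ≤ n`) with Satake parameter `α` w.r.t. the uniformiser `ϖ`, and assume the named fact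
`hasRSLFactor_of_isSatakeParameter_haar` for the pair `(π_v, 1_{GL₁})` (hypothesis `hJS`).  Then
`A₀ := (d.recGL n ⟦π_v⟧).out` has `N = 0`, trivial inertia action, and
`char(A₀.ρ Φ₀) = ∏_{a ∈ α} (X - a)` at the chosen geometric Frobenius `Φ₀`: `hJS` (with
`π_v` admissible by `jacquetAdmissibility_gl_holds`, `1_{GL₁}` admissible generic with Satake
parameter `{1}`, `ν` an invariant measure on `GL₁(F) ⧸ U₁`) gives
`HasRSLFactor (π_v, 1) (∏ (1 - a T))`, clause (iii-L) of `d` identifies `∏ (1 - a T)` with the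
Euler factor of `A₀ ⊗ rec(1)`, `rec(1) ≅ (1 ∘ artin, 0)` by clause (ii); all `a ≠ 0`
(`IsSatakeParameter.forall_ne_zero_holds`) so the Euler factor has degree `n = dim`, whence
`(ker N)^I = A₀ ⊗ rec(1)`, `N = 0`, inertia trivial, and `det(1 - TΦ₀ | A₀) = ∏ (1 - a T)`, i.e.
`char(A₀.ρ Φ₀) = ∏ (X - a)` by reflection in degree `n`.
[cite: JacquetShalika1981, §2] [cite: HarrisTaylorAMS2001, Thm. A (ii), (v)]
[cite: TateCorvallis1979, (4.1.6)] -/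
theorem recGL_out_unramified_of_isSatakeParameter_recGLn (d : LocalLanglandsDatum F) {n : ℕ}
    (hn : 1 < n) (πv : SmoothIrrep (GL (Fin n) F)) {ψ : AddChar F Circle}
    (hψ : ψ.IsContinuousNontrivial) (hgen : IsGeneric πv.ρ ψ) {ϖ : Fˣ}
    (hϖ : (ValuativeRel.valuation F).IsUniformizer (ϖ : F)) {α : Multiset ℂ}
    (hα : IsSatakeParameter πv.ρ ϖ α)
    (hJS : ∀ (ψ : AddChar F Circle)
        [MeasurableSpace (GL (Fin 1) F ⧸ upperUnitriangular (Fin 1) F)]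
        [BorelSpace (GL (Fin 1) F ⧸ upperUnitriangular (Fin 1) F)]
        (ν : MeasureTheory.Measure (GL (Fin 1) F ⧸ upperUnitriangular (Fin 1) F))
        [MeasureTheory.SMulInvariantMeasure (GL (Fin 1) F)
          (GL (Fin 1) F ⧸ upperUnitriangular (Fin 1) F) ν]
        [MeasureTheory.IsFiniteMeasureOnCompacts ν] [ν.IsOpenPosMeasure],
        hasRSLFactor_of_isSatakeParameter_haar hn πv.ρ
          (Representation.trivial ℂ (GL (Fin 1) F) ℂ) ψ ν) :
    ((d.recGL n (IrrClass.mk πv)).out.1).N = 0 ∧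
      (∀ u ∈ WeilGroup.inertia F, ((d.recGL n (IrrClass.mk πv)).out.1).ρ u = 1) ∧
      (((d.recGL n (IrrClass.mk πv)).out.1).ρ (WeilDeligneRep.geomFrob F d.hex)).charpoly =
        (α.map fun a => X - C a).prod := by
  classical
  haveI := πv.isIrreducible
  haveI hirr1 : (Representation.trivial ℂ (GL (Fin 1) F) ℂ).IsIrreducible :=
    isIrreducible_trivial_complex _
  have hadm1 : (Representation.trivial ℂ (GL (Fin 1) F) ℂ).IsAdmissible :=
    isAdmissible_trivial_complex _
  have hadm : πv.ρ.IsAdmissible :=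
    jacquetAdmissibility_gl_holds F n πv.V πv.ρ πv.isSmooth πv.isIrreducible
  -- an invariant measure on `GL₁(F) ⧸ U₁`, finite on compacts and positive on opens
  letI : MeasurableSpace F := borel F
  haveI : BorelSpace F := ⟨rfl⟩
  letI : MeasurableSpace (GL (Fin 1) F ⧸ upperUnitriangular (Fin 1) F) := borel _
  haveI : BorelSpace (GL (Fin 1) F ⧸ upperUnitriangular (Fin 1) F) := ⟨rfl⟩
  obtain ⟨_, _, ν, hinv, hfin, hpos, -⟩ := exists_haar_measure_quotient_fin_one (F := F)
  haveI := hinv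
  haveI := hfin
  haveI := hpos
  -- the trivial irreducible smooth representation of `GL₁(F)` on `ℂ`: generic, Satake parameter `{1}`
  let π' : SmoothIrrep (GL (Fin 1) F) :=
    { V := ℂ
      ρ := Representation.trivial ℂ (GL (Fin 1) F) ℂ
      isIrreducible := hirr1
      isSmooth := hadm1.isSmooth }
  have hgen' : IsGeneric π'.ρ ψ⁻¹ := isGeneric_of_fin_one _ _
  have hβ : IsSatakeParameter π'.ρ ϖ ({1} : Multiset ℂ) :=
    (isSatakeParameter_trivial_gl_one_iff ϖ {1}).2 rfl
  -- the Jacquet–Shalika unramified computation (hypothesis): `L(s, π_v × 1) = ∏ (1 - a q^{-s})⁻¹`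
  have hRS : HasRSLFactor hn πv.ρ π'.ρ ψ ν (satakePairPolynomial α {1}) :=
    hJS ψ ν hadm hadm1 hgen hgen' hψ hϖ hα hβ
  -- (iii-L): `∏ (1 - a T)` is the Euler factor of `A₀ ⊗ B₀`
  set A₀ := (d.recGL n (IrrClass.mk πv)).out.1 with hA₀
  set B₀ := (d.recGL 1 (IrrClass.mk π')).out.1 with hB₀
  have hP₀ : satakePairPolynomial α {1} = (A₀.tprod B₀).eulerFactor d.hn d.hex :=
    (d.isLocalLanglands.lFactor_pairs Nat.one_pos hn πv π' ψ hψ hgen hgen' ν _).mp hRS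
  -- (ii): `B₀ ≅ (1 ∘ artin, 0)`, so `B₀.N = 0` and `B₀.ρ = 1`
  have hgl : B₀.IsEquivalent (WeilDeligneRep.ofQuasiChar d.hns d.artin 1) :=
    d.isLocalLanglands.gl_one 1 π' fun g v => by simp [π']
  obtain ⟨e⟩ := hgl
  set φ : (Fin 1 → ℂ) ≃ₗ[ℂ] ℂ := e.toRepEquiv.toLinearEquiv with hφ
  have hφρ : ∀ (u : WeilGroup F) (y : Fin 1 → ℂ),
      φ (B₀.ρ u y) = (WeilDeligneRep.ofQuasiChar d.hns d.artin 1).ρ u (φ y) := fun u y => by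
    rw [hφ, Representation.Equiv.toLinearEquiv_apply, Representation.Equiv.toLinearEquiv_apply]
    exact Representation.IntertwiningMap.isIntertwining _ _ e.toRepEquiv.toIntertwiningMap u y
  have hφN : ∀ y : Fin 1 → ℂ, φ (B₀.N y) = (WeilDeligneRep.ofQuasiChar d.hns d.artin 1).N (φ y) :=
    fun y => LinearMap.congr_fun e.comm_N y
  have hBρ : ∀ (u : WeilGroup F) (y : Fin 1 → ℂ), B₀.ρ u y = y := by
    intro u y
    apply φ.injective
    rw [hφρ, WeilDeligneRep.ofQuasiChar_ρ_apply]
    simp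
  have hBN : B₀.N = 0 := by
    refine LinearMap.ext fun y => φ.injective ?_
    rw [hφN, WeilDeligneRep.ofQuasiChar_N, LinearMap.zero_apply, LinearMap.zero_apply, map_zero]
  -- all `a ≠ 0`, so the Euler factor has degree `n = dim (A₀ ⊗ B₀)` and `(ker N)^I` is everything
  have hfr : Module.finrank ℂ (TensorProduct ℂ (Fin n → ℂ) (Fin 1 → ℂ)) = n := by
    rw [Module.finrank_tensorProduct, Module.finrank_fin_fun, Module.finrank_fin_fun, mul_one]
  have hcard : Multiset.card α = n := hα.1
  have hne : ∀ a ∈ α, a ≠ 0 := IsSatakeParameter.forall_ne_zero_holds hϖ hα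
  have hPdeg : ((A₀.tprod B₀).eulerFactor d.hn d.hex).natDegree = n := by
    rw [← hP₀, satakePairPolynomial_singleton_one, natDegree_prod_one_sub_C_mul_X_recGLn hne, hcard]
  have htop : (A₀.tprod B₀).inertiaInvariantsKerN = ⊤ :=
    inertiaInvariantsKerN_eq_top_of_natDegree_eulerFactor_eq _ d.hn d.hex (hPdeg.trans hfr.symm)
  obtain ⟨hAN, hAρ⟩ := N_eq_zero_and_inertia_trivial_of_tprod_eq_top A₀ B₀ hBN hBρ htop
  -- the Euler factor is the reversed characteristic polynomial of `A₀.ρ Φ₀`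
  have hrev : (A₀.ρ (WeilDeligneRep.geomFrob F d.hex)).charpoly.reverse =
      (α.map fun a => (1 : ℂ[X]) - C a * X).prod := by
    rw [← charpoly_tprod_ρ_eq A₀ B₀ hBρ (WeilDeligneRep.geomFrob F d.hex),
      ← eulerFactor_eq_reverse_charpoly_of_eq_top _ d.hn d.hex htop, ← hP₀,
      satakePairPolynomial_singleton_one]
  refine ⟨hAN, hAρ, eq_prod_X_sub_C_of_reverse_eq_recGLn ?_ hrev⟩
  rw [LinearMap.charpoly_natDegree, Module.finrank_fin_fun, hcard]

/-- **Every Frobenius-semisimple representative of `rec(π_v)` is unramified with the Satake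
characteristic polynomial at every geometric Frobenius**, modulo the Jacquet–Shalika unramified
computation at `(n, 1)` (hypothesis `hJS`): for `A` Frobenius-semisimple with
`d.recGL n ⟦π_v⟧ = ⟦A⟧`, `A.N = 0`, `A.ρ` is trivial on inertia, and
`char(A.ρ Φ) = ∏_{a ∈ α} (X - a)` whenever `deg Φ = -1`.  From
`recGL_out_unramified_of_isSatakeParameter_recGLn` by `A ≅ (d.recGL n ⟦π_v⟧).out`
(`Quotient.exact`) and `A.ρ Φ = A.ρ Φ₀` (the two geometric Frobenii differ by inertia).
[cite: JacquetShalika1981, §2] [cite: HarrisTaylorAMS2001, Thm. A (ii), (v)]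
[cite: TateCorvallis1979, (4.1.6)] -/
theorem recGL_unramified_of_isSatakeParameter_of_unramifiedComputation_recGLn
    (d : LocalLanglandsDatum F) {n : ℕ} (hn : 1 < n) (πv : SmoothIrrep (GL (Fin n) F))
    {ψ : AddChar F Circle} (hψ : ψ.IsContinuousNontrivial) (hgen : IsGeneric πv.ρ ψ) {ϖ : Fˣ}
    (hϖ : (ValuativeRel.valuation F).IsUniformizer (ϖ : F)) {α : Multiset ℂ}
    (hα : IsSatakeParameter πv.ρ ϖ α)
    (hJS : ∀ (ψ : AddChar F Circle)
        [MeasurableSpace (GL (Fin 1) F ⧸ upperUnitriangular (Fin 1) F)]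
        [BorelSpace (GL (Fin 1) F ⧸ upperUnitriangular (Fin 1) F)]
        (ν : MeasureTheory.Measure (GL (Fin 1) F ⧸ upperUnitriangular (Fin 1) F))
        [MeasureTheory.SMulInvariantMeasure (GL (Fin 1) F)
          (GL (Fin 1) F ⧸ upperUnitriangular (Fin 1) F) ν]
        [MeasureTheory.IsFiniteMeasureOnCompacts ν] [ν.IsOpenPosMeasure],
        hasRSLFactor_of_isSatakeParameter_haar hn πv.ρ
          (Representation.trivial ℂ (GL (Fin 1) F) ℂ) ψ ν)
    (A : WeilDeligneRep F ℂ (Fin n → ℂ)) (hA : A.IsFrobSemisimple)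
    (hrec : d.recGL n (IrrClass.mk πv) = Quotient.mk (frobSemisimpleWDSetoid F n) ⟨A, hA⟩) :
    A.N = 0 ∧ WeilGroup.IsUnramifiedRep A.ρ ∧
      ∀ Φ : WeilGroup F, WeilGroup.deg Φ = -1 →
        (A.ρ Φ).charpoly = (α.map fun a => X - C a).prod := by
  obtain ⟨hAN, hAρ, hch⟩ :=
    recGL_out_unramified_of_isSatakeParameter_recGLn d hn πv hψ hgen hϖ hα hJS
  have hAA : ((d.recGL n (IrrClass.mk πv)).out.1).IsEquivalent A :=
    Quotient.exact ((Quotient.out_eq _).trans hrec)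
  obtain ⟨hN, hur, hchar⟩ := wd_unramified_charpoly_of_isEquivalent_recGLn hAA.symm hAN hAρ
  refine ⟨hN, hur, fun Φ hΦ => ?_⟩
  rw [wd_apply_eq_of_isUnramifiedRep_of_deg_eq_recGLn hur
      (hΦ.trans (WeilDeligneRep.deg_geomFrob d.hmul d.huniq d.hex).symm), hchar, hch]

end Local

/-! ### The registered stub -/

/-- **stub H4 (automorphic side, `GL_n`, modulo the Jacquet–Shalika unramified computation).**  For
a cuspidal `π` on `GL_n(𝔸_K)` (`2 ≤ n`) with Satake parameter `α` at `v`, a local component `π_v`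
of `π` at `v` and ANY local Langlands datum `L` of `K_v`, granting the named fact
`hasRSLFactor_of_isSatakeParameter_haar` of `RankinSelbergLocal` at `(n, 1)` for `(π_v, 1)` — the
JPSS `L`-polynomial of `(π_v, 1)` is `∏_{a ∈ α} (1 - a T)` (Jacquet–Shalika 1981 §2; in the tree for
`n = 2` only): every Frobenius-semisimple representative `A` of `L.recGL n ⟦π_v⟧` has `N = 0`, is
trivial on inertia, and `char(A.ρ Φ) = ∏_{a ∈ α} (X - a)` for every geometric Frobenius `Φ`.
Proof: `π_v` is generic for a continuous non-trivial `ψ`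
(`CuspidalAutomorphicRepData.exists_isGeneric_of_hasLocalComponentAt`), `α` is a Satake parameter
of `π_v` w.r.t. the uniformiser `artin Φ₀`
(`CuspidalAutomorphicRepData.isSatakeParameter_of_hasLocalComponentAt`), and
`recGL_unramified_of_isSatakeParameter_of_unramifiedComputation_recGLn` (clause (iii-L) of `L`,
degree count with `a ≠ 0`, `(ker N)^I = ⊤`, `det(1 - TΦ) = ∏ (1 - a T)`).
[cite: JacquetShalika1981, §2] [cite: HarrisTaylorAMS2001, Thm. A (ii), (v)]
[cite: TateCorvallis1979, (4.1.6)] -/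
theorem stub_recGL_unramified_of_unramifiedComputation :
    ∀ (K : Type) [Field K] [NumberField K] (n : ℕ) (hn : 1 < n) (hcpt : isCompact_glFiniteIntegralLevel n K)
      (π : CuspidalAutomorphicRepData n K hcpt) (v : HeightOneSpectrum (𝓞 K)) (α : Multiset ℂ),
      π.1.HasSatakeParamAt v α →
      ∀ (L : LocalLanglandsDatum (v.adicCompletion K))
        (πv : SmoothIrrep (GL (Fin n) (v.adicCompletion K))), π.1.HasLocalComponentAt v πv.ρ →
        (∀ (ψ : AddChar (v.adicCompletion K) Circle)
            [MeasurableSpace (GL (Fin 1) (v.adicCompletion K) ⧸ upperUnitriangular (Fin 1) (v.adicCompletion K))]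
            [BorelSpace (GL (Fin 1) (v.adicCompletion K) ⧸ upperUnitriangular (Fin 1) (v.adicCompletion K))]
            (ν : MeasureTheory.Measure
              (GL (Fin 1) (v.adicCompletion K) ⧸ upperUnitriangular (Fin 1) (v.adicCompletion K)))
            [MeasureTheory.SMulInvariantMeasure (GL (Fin 1) (v.adicCompletion K))
              (GL (Fin 1) (v.adicCompletion K) ⧸ upperUnitriangular (Fin 1) (v.adicCompletion K)) ν]
            [MeasureTheory.IsFiniteMeasureOnCompacts ν] [ν.IsOpenPosMeasure],
            hasRSLFactor_of_isSatakeParameter_haar hn πv.ρ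
              (Representation.trivial ℂ (GL (Fin 1) (v.adicCompletion K)) ℂ) ψ ν) →
        ∀ (A : WeilDeligneRep (v.adicCompletion K) ℂ (Fin n → ℂ)) (hA : A.IsFrobSemisimple),
          L.recGL n (IrrClass.mk πv) =
            Quotient.mk (frobSemisimpleWDSetoid (v.adicCompletion K) n) ⟨A, hA⟩ →
          A.N = 0 ∧ WeilGroup.IsUnramifiedRep A.ρ ∧
            ∀ Φ : WeilGroup (v.adicCompletion K), WeilGroup.deg Φ = -1 →
              (A.ρ Φ).charpoly = (α.map fun a => X - C a).prod := by
  intro K _ _ n hn hcpt π v α hαsat L πv hloc hJS A hA hrec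
  haveI : NeZero n := ⟨by omega⟩
  haveI := πv.isIrreducible
  obtain ⟨ψ, hψ, hgen⟩ := π.exists_isGeneric_of_hasLocalComponentAt v πv.ρ πv.isSmooth hloc
  have hϖ := L.artin.artin_frob (WeilDeligneRep.geomFrob _ L.hex)
    (WeilDeligneRep.deg_geomFrob L.hmul L.huniq L.hex)
  have hαv := π.isSatakeParameter_of_hasLocalComponentAt v πv.ρ πv.isSmooth hloc hαsat hϖ
  exact recGL_unramified_of_isSatakeParameter_of_unramifiedComputation_recGLn L hn πv hψ hgen hϖ
    hαv hJS A hA hrec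

end Summit.Langlands.Langlands.Theorems.ReciprocityUpToIrreducibility
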